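import Literature.AlgebraicGeometry.Resolution.DerivationCompletion
import Mathlib.RingTheory.Localization.AtPrime.Basic
import HarnessLib

/-!
# Giraud's Jacobian content ideal `J(X, f)` via derivations, and its localisation

Route `ResolutionOfSingularities/RadicialJung`, crux `CleanModels` (stmt-ResolutionOfSingularities-15917),
line `via-clean-models` of crux `DescentPerfectToAll` (stmt-ResolutionOfSingularities-0549): brick
K3c-i of PROGRAMME-clean-dim2 (Giraud's normal form over an ARBITRARY ground field). Helper file
(`--supports`), OURS; nothing here is a statement of Hironaka's manuscript.

Giraud (Bull. SMF 111 (1983), 1.1 (2)–(4)) attaches to a function `f` on a regular scheme `X` of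
characteristic `p` the coherent ideal `J(X, f)` generated by the coefficients of `df` in a local
basis of `Ω¹_X` (for him of FINITE rank); its zero set is `E(f)`, and the invariants `m`, `c` of §2
are read off it. Over an arbitrary ground field `Ω_{X/𝔽_p}` is still locally free on the regular locus
(`exists_free_kaehler_localization_away`) but of infinite rank, so `J` has to be handled without
finiteness of the basis. This file gives the intrinsic, basis-free description and its compatibility
with localisation, on any ring `B` whose module of absolute differentials `Ω[B⁄ℤ]` is free:

* `span_range_derivation_apply_eq_span_range_repr` — the ideal generated by all values `D f`,
  `D ∈ Der(B)`, equals the ideal generated by the coordinates of `df` in a basis `b` of `Ω[B⁄ℤ]`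
  (so it is finitely generated, and independent of `b`);
* `map_span_range_repr_eq_span_range_derivation_apply` — for ANY localisation `B_𝔮` of `B` at a
  prime `𝔮`: the extension of that ideal to `B_𝔮` is the ideal generated by the values `D (f/1)`,
  `D ∈ Der(B_𝔮)` — i.e. Giraud's `J(X, f)` is a quasi-coherent ideal whose stalks are the intrinsic
  content ideals `{D f : D ∈ Der(𝒪_{X,x})}` (Stacks 07PE: derivations extend to localisations, and
  `Ω[B_𝔮⁄ℤ] = (Ω[B⁄ℤ])_𝔮`).

## References
* J. Giraud, *Forme normale d'une fonction sur une surface de caractéristique positive*, Bull. Soc.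
  Math. France 111 (1983), 1.1 (2)–(4), 1.2. [Giraud1983]
* The Stacks Project, Tag 07PE. [StacksProject]
-/

noncomputable section

set_option linter.dupNamespace false -- mandated namespace of this single-conjunct summit

open KaehlerDifferential Module IsLocalRing
open Literature.AlgebraicGeometry.Resolution

namespace Summit.ResolutionOfSingularities.ResolutionOfSingularities.Theorems.RadicialJung.CleanModels

universe u v w

/-- **The content ideal of `df` via derivations.** If `Ω[B⁄ℤ]` is free on a basis `b`, the ideal
generated by the values `D f` of all derivations `D` of `B` is the ideal generated by the
coordinates of `df` in `b` (Giraud's `J(X, f)`, 1.1 (2)). [cite: Giraud1983, 1.1 (2)] -/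
theorem span_range_derivation_apply_eq_span_range_repr {B : Type u} [CommRing B] {ι : Type v}
    (b : Basis ι B Ω[B⁄ℤ]) (f : B) :
    Ideal.span (Set.range fun D : Derivation ℤ B B => D f) =
      Ideal.span (Set.range fun i => b.repr (D ℤ B f) i) := by
  classical
  apply le_antisymm
  · rw [Ideal.span_le]
    rintro _ ⟨D', rfl⟩
    have hD : D' f =
        D'.liftKaehlerDifferential (Finsupp.linearCombination B b (b.repr (D ℤ B f))) := by
      rw [b.linearCombination_repr, Derivation.liftKaehlerDifferential_comp_D]
    change D' f ∈ _
    rw [hD, Finsupp.apply_linearCombination, Finsupp.linearCombination_apply]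
    refine Ideal.sum_mem _ fun i _ => ?_
    dsimp only [Function.comp_apply]
    rw [smul_eq_mul, mul_comm]
    exact Ideal.mul_mem_left _ _ (Ideal.subset_span (Set.mem_range_self i))
  · rw [Ideal.span_le]
    rintro _ ⟨i, rfl⟩
    exact Ideal.subset_span ⟨(b.coord i).compDer (D ℤ B), rfl⟩

/-- **Localisation of the content ideal.** If `Ω[B⁄ℤ]` is free on a basis `b` and `B_𝔮` is any
localisation of `B` at a prime `𝔮`, the extension to `B_𝔮` of the ideal of coordinates of `df` is
the ideal generated by the values `D (f/1)`, `D ∈ Der(B_𝔮)`: Giraud's `J(X, f)` localises to the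
intrinsic content ideal of the local ring. [cite: Giraud1983, 1.1 (2)] [cite: StacksProject, Tag 07PE] -/
theorem map_span_range_repr_eq_span_range_derivation_apply {B : Type u} [CommRing B] {ι : Type v}
    (b : Basis ι B Ω[B⁄ℤ]) (f : B) (Q : Ideal B) [Q.IsPrime] (Bq : Type w) [CommRing Bq]
    [Algebra B Bq] [IsLocalization.AtPrime Bq Q] :
    (Ideal.span (Set.range fun i => b.repr (D ℤ B f) i)).map (algebraMap B Bq) =
      Ideal.span (Set.range fun D : Derivation ℤ Bq Bq => D (algebraMap B Bq f)) := by
  classical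
  apply le_antisymm
  · -- each coordinate `cᵢ` is the value on `f` of the coordinate derivation, which extends to `B_𝔮`
    rw [Ideal.map_span, Ideal.span_le]
    rintro _ ⟨_, ⟨i, rfl⟩, rfl⟩
    let δ : Derivation ℤ B B := (b.coord i).compDer (D ℤ B)
    have hδ : δ f = b.repr (D ℤ B f) i := rfl
    obtain ⟨δ', hδ'⟩ := exists_derivation_extend_of_isLocalizedModule Q.primeCompl Bq
      (Algebra.linearMap B Bq) δ
    refine Ideal.subset_span ⟨δ', ?_⟩
    change δ' (algebraMap B Bq f) = algebraMap B Bq (b.repr (D ℤ B f) i)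
    rw [hδ', Algebra.linearMap_apply, hδ]
  · -- each `D (f/1)` is a combination of the `cᵢ`
    rw [Ideal.span_le]
    rintro _ ⟨D', rfl⟩
    let δ : Derivation ℤ B Bq := D'.compAlgebraMap B
    have hδf : D' (algebraMap B Bq f) =
        δ.liftKaehlerDifferential (Finsupp.linearCombination B b (b.repr (D ℤ B f))) := by
      rw [b.linearCombination_repr, Derivation.liftKaehlerDifferential_comp_D]
      rfl
    change D' (algebraMap B Bq f) ∈ _
    rw [hδf, Finsupp.apply_linearCombination, Finsupp.linearCombination_apply]
    refine Ideal.sum_mem _ fun i _ => ?_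
    dsimp only [Function.comp_apply]
    rw [Algebra.smul_def, mul_comm]
    exact Ideal.mul_mem_left _ _
      (Ideal.mem_map_of_mem (algebraMap B Bq) (Ideal.subset_span (Set.mem_range_self i)))

/-- Corollary: with two bases the coordinate ideals agree (both are the derivation content ideal).
[cite: Giraud1983, 1.1 (2)] -/
theorem span_range_repr_eq_of_basis {B : Type u} [CommRing B] {ι ι' : Type v}
    (b : Basis ι B Ω[B⁄ℤ]) (b' : Basis ι' B Ω[B⁄ℤ]) (f : B) :
    Ideal.span (Set.range fun i => b.repr (D ℤ B f) i) =
      Ideal.span (Set.range fun i => b'.repr (D ℤ B f) i) := by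
  rw [← span_range_derivation_apply_eq_span_range_repr b f,
    span_range_derivation_apply_eq_span_range_repr b' f]

/-- Corollary (`E(f) = V(J(f))` pointwise): for a prime `𝔮` and any localisation `B_𝔮`, the content
ideal of `f/1` in `B_𝔮` is contained in the maximal ideal iff all coordinates of `df` lie in `𝔮`.
[cite: Giraud1983, Déf. 1.2] -/
theorem span_range_derivation_apply_le_maximalIdeal_iff {B : Type u} [CommRing B] {ι : Type v}
    (b : Basis ι B Ω[B⁄ℤ]) (f : B) (Q : Ideal B) [Q.IsPrime] (Bq : Type w) [CommRing Bq]
    [Algebra B Bq] [IsLocalization.AtPrime Bq Q] [IsLocalRing Bq] :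
    Ideal.span (Set.range fun D : Derivation ℤ Bq Bq => D (algebraMap B Bq f)) ≤ maximalIdeal Bq ↔
      ∀ i, b.repr (D ℤ B f) i ∈ Q := by
  rw [← map_span_range_repr_eq_span_range_derivation_apply b f Q Bq, Ideal.map_le_iff_le_comap,
    Ideal.span_le]
  constructor
  · intro h i
    have := h ⟨i, rfl⟩
    rw [SetLike.mem_coe, Ideal.mem_comap,
      IsLocalization.AtPrime.to_map_mem_maximal_iff Bq Q] at this
    exact this
  · rintro h _ ⟨i, rfl⟩
    rw [SetLike.mem_coe, Ideal.mem_comap, IsLocalization.AtPrime.to_map_mem_maximal_iff Bq Q]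
    exact h i

end Summit.ResolutionOfSingularities.ResolutionOfSingularities.Theorems.RadicialJung.CleanModels

end
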